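import Literature.AlgebraicGeometry.ProjectiveSpace.CoverIdealSymbolicPowers
import Mathlib.Combinatorics.SimpleGraph.Coloring.Constructions
import HarnessLib

/-!
# When is `J(G)^{(2)}` generated by `J(G)^2` and `x_1 ⋯ x_n`? Odd cycles dominating every vertex
# (Herzog–Hibi–Trung, Proposition 5.3)

Topic `Literature/AlgebraicGeometry/ProjectiveSpace`, namespace
`Literature.AlgebraicGeometry.ProjectiveSpace`. Lane `lit-hodgefound`, seat `lit-hodgefound-p32`,
row gen31-#19. Theorems only (no `def`, no named fact). Sequel to `CoverIdealSymbolicPowers`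
(gen31-#15: `J(G)^{(n)} = ⋂_{u ∼ v} (x_u, x_v)^n`, vertex covers of order `n`, Theorem 5.1).

## The source, as printed

J. Herzog, T. Hibi, N. V. Trung, *Symbolic powers of monomial ideals and vertex cover algebras*,
**Proposition 5.3.** "Let `G` be a finite graph on `[n]` with `E(G)` its edge set. Then the following
conditions are equivalent: (i) The graded `S`-algebra `A(G)` is generated by the monomial
`x_1 x_2 ⋯ x_n t^2` together with those monomials `x_1^{a(1)} ⋯ x_n^{a(n)} t` such that `(a(1), …,
a(n))` is a minimal vertex cover of `G`; (ii) For every cycle `C` of `G` of odd length and for every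
vertex `i ∈ [n]` there exists a vertex `j` of `C` with `{i, j} ∈ E(G)`." Proof of (i) ⇒ (ii): "define
`a` by setting `a(j) = 1` if `j ∈ V(C)`, `a(i_0) = 0`, and `a(k) = 2` if `k ∈ [n] ∖ (V(C) ∪ {i_0})`";
of (ii) ⇒ (i): "if `V ⊂ [n]` is the set of those `i` with `a(i) = 1` and if `G'` is the induced
subgraph of `G` on `V`, then `G'` possesses no odd cycle. Hence `G'` is a bipartite graph … define `b`
by setting `b(i) = 1` if either `a(i) ≥ 2` or `i ∈ V_1`, and `b(i) = 0` if either `a(i) = 0` or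
`i ∈ V_2` … `b' = a − b`".

## What is here

Since `A(G)` is generated in degrees `≤ 2` (Theorem 5.1 (a), gen31-#15), condition (i) is the ideal
identity `J(G)^{(2)} = J(G)^2 + (x_1 ⋯ x_n)`; "cycle of odd length" is rendered as a closed walk of
odd length (equivalent for (ii): an odd closed walk contains an odd cycle among its vertices), which
is how Mathlib characterises bipartite graphs (`two_colorable_iff_forall_loop_even`).

* § 1 monomials in a sum of monomial ideals; the principal ideal `(x_1 ⋯ x_n)`;
  `J(G)^2 + (x_1 ⋯ x_n) ⊆ J(G)^{(2)}` always.
* § 2 **(i) ⇒ (ii)** with the printed cover `a = 𝟙_{V(C)} + 2·𝟙_{rest}`, `a(i_0) = 0`: two vertex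
  covers below `a` would 2-colour the odd closed walk.
* § 3 **(ii) ⇒ (i)** with the printed splitting `a = b + b'` from a 2-colouring of the induced
  subgraph on `{a = 1}`.
* § 4 **Proposition 5.3 as an equivalence**; bipartite graphs satisfy it.

## References

* [HerzogHibiTrung2007] J. Herzog, T. Hibi, N. V. Trung, *Symbolic powers of monomial ideals and
  vertex cover algebras*, Adv. Math. 210 (2007) 304–322, Prop. 5.3, Thm. 5.1.
-/

noncomputable section

open Finset MvPolynomial
open Literature.RingTheory.MvPolynomial

universe u

namespace Literature.AlgebraicGeometry.ProjectiveSpace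

variable {σ : Type*} [Fintype σ] [DecidableEq σ] (G : SimpleGraph σ)
variable {k : Type u} [Field k]

/-! ### § 1 Monomials in sums of monomial ideals; the ideal `(x_1 ⋯ x_n)` -/

omit [Fintype σ] [DecidableEq σ] in
/-- A monomial lying in a sum of two monomial ideals lies in one of them.
[cite: HerzogHibiTrung2007, Prop. 5.3 (proof: "`x^a t^2` cannot be divided by `x_1 ⋯ x_n t^2` …
impossible to write `a = b + b'`")] -/
theorem monomial_mem_or_of_mem_sup {I I' : Ideal (MvPolynomial σ k)}
    (hI : ∀ g ∈ I, ∀ u ∈ g.support, (monomial u (1 : k)) ∈ I)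
    (hI' : ∀ g ∈ I', ∀ u ∈ g.support, (monomial u (1 : k)) ∈ I') {a : σ →₀ ℕ}
    (h : (monomial a (1 : k) : MvPolynomial σ k) ∈ I ⊔ I') :
    (monomial a (1 : k) : MvPolynomial σ k) ∈ I ∨ (monomial a (1 : k) : MvPolynomial σ k) ∈ I' := by
  classical
  obtain ⟨f, hf, g, hg, hfg⟩ := Submodule.mem_sup.mp h
  have hcoeff : f.coeff a + g.coeff a = 1 := by
    rw [← coeff_add, hfg, coeff_monomial, if_pos rfl]
  by_cases hfa : f.coeff a = 0
  · right
    rw [hfa, zero_add] at hcoeff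
    exact hI' g hg a (mem_support_iff.mpr (by rw [hcoeff]; exact one_ne_zero))
  · exact Or.inl (hI f hf a (mem_support_iff.mpr hfa))

/-- `x^a ∈ (x_1 ⋯ x_n)` iff every exponent is `≥ 1`. [cite: HerzogHibiTrung2007, Prop. 5.3 (proof)] -/
theorem monomial_mem_span_prod_X_iff (a : σ →₀ ℕ) :
    (monomial a (1 : k) : MvPolynomial σ k) ∈ Ideal.span {∏ i, (X i : MvPolynomial σ k)} ↔
      ∀ i, 1 ≤ a i := by
  classical
  rw [prod_X_eq_monomial_sum_single, ← Set.image_singleton (f := fun s : σ →₀ ℕ => monomial s (1 : k)),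
    mem_ideal_span_monomial_image]
  have happ : ∀ j, (∑ i ∈ (univ : Finset σ), Finsupp.single i 1 : σ →₀ ℕ) j = 1 := by
    intro j
    rw [Finsupp.finsetSum_apply]
    simp only [Finsupp.single_apply]
    rw [Finset.sum_ite_eq', if_pos (Finset.mem_univ j)]
  constructor
  · intro h i
    obtain ⟨s, hs, hle⟩ := h a (by rw [support_monomial, if_neg one_ne_zero]; exact mem_singleton_self a)
    rw [Set.mem_singleton_iff.mp hs] at hle
    have := hle i
    rwa [happ] at this
  · intro h b hb
    rw [support_monomial, if_neg one_ne_zero, Finset.mem_singleton] at hb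
    subst hb
    exact ⟨_, rfl, fun i => by rw [happ]; exact h i⟩

omit [DecidableEq σ] in
/-- `(x_1 ⋯ x_n)` is a monomial ideal. [cite: HerzogHibiTrung2007, Prop. 5.3] -/
theorem monomial_mem_span_prod_X_of_mem_support :
    ∀ g ∈ Ideal.span {∏ i, (X i : MvPolynomial σ k)}, ∀ a ∈ g.support,
      (monomial a (1 : k) : MvPolynomial σ k) ∈ Ideal.span {∏ i, (X i : MvPolynomial σ k)} := by
  rw [prod_X_eq_monomial_sum_single, ← Set.image_singleton (f := fun s : σ →₀ ℕ => monomial s (1 : k))]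
  exact monomial_mem_span_monomial_image_of_mem_support _

/-- `J(G)^2 + (x_1 ⋯ x_n) ⊆ J(G)^{(2)}` for every graph. [cite: HerzogHibiTrung2007, Prop. 5.3 and
Thm. 5.1] -/
theorem sq_sup_span_prod_X_le_symbolic_two :
    (Ideal.span ((fun W : Finset σ => ∏ i ∈ W, (X i : MvPolynomial σ k)) ''
        {W : Finset σ | ∀ u v, G.Adj u v → u ∈ W ∨ v ∈ W})) ^ 2 ⊔
        Ideal.span {∏ i, (X i : MvPolynomial σ k)} ≤
      ⨅ p ∈ {p : σ × σ | G.Adj p.1 p.2}, (Ideal.span ({X p.1, X p.2} : Set (MvPolynomial σ k))) ^ 2 := by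
  refine sup_le (coverIdeal_pow_le_symbolicCoverIdeal G 2) ?_
  rw [Ideal.span_le, Set.singleton_subset_iff]
  exact prod_X_mem_symbolicCoverIdeal_two G

/-! ### § 2 (i) ⇒ (ii): odd closed walks dominate every vertex -/

omit [Fintype σ] [DecidableEq σ] in
/-- Two vertex covers `W₁, W₂` of `G` which are disjoint along a closed walk 2-colour it, so the walk
has even length. [cite: HerzogHibiTrung2007, Thm. 5.1 (b) (proof of "only if") and Prop. 5.3] -/
theorem even_length_of_disjoint_covers {u₀ : σ} (w : G.Walk u₀ u₀) {W₁ W₂ : Finset σ}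
    (hW₁ : ∀ u v, G.Adj u v → u ∈ W₁ ∨ v ∈ W₁) (hW₂ : ∀ u v, G.Adj u v → u ∈ W₂ ∨ v ∈ W₂)
    (hdisj : ∀ x y, s(x, y) ∈ w.edges → ¬ (x ∈ W₁ ∧ x ∈ W₂)) : Even w.length := by
  classical
  -- the graph of the edges of `w`, 2-coloured by membership in `W₁`
  let H : SimpleGraph σ := SimpleGraph.fromEdgeSet {e | e ∈ w.edges}
  have hcol : ∀ x y, H.Adj x y → (decide (x ∈ W₁) : Bool) ≠ decide (y ∈ W₁) := by
    intro x y hxy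
    rw [SimpleGraph.fromEdgeSet_adj] at hxy
    have he : s(x, y) ∈ w.edges := hxy.1
    have hadj : G.Adj x y := w.adj_of_mem_edges he
    have hx := hdisj x y he
    have hy := hdisj y x (by rw [Sym2.eq_swap]; exact he)
    have h1 := hW₁ x y hadj
    have h2 := hW₂ x y hadj
    intro heq
    simp only [decide_eq_decide] at heq
    tauto
  let c : H.Coloring Bool := SimpleGraph.Coloring.mk (fun x => decide (x ∈ W₁)) (fun {x y} h => hcol x y h)
  have hw' : ∀ e, e ∈ w.edges → e ∈ H.edgeSet := by
    intro e he
    induction e using Sym2.ind with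
    | _ x y =>
      rw [SimpleGraph.mem_edgeSet, SimpleGraph.fromEdgeSet_adj]
      exact ⟨he, (w.adj_of_mem_edges he).ne⟩
  have := (c.even_length_iff_congr (w.transfer H hw')).mpr Iff.rfl
  rwa [SimpleGraph.Walk.length_transfer] at this

/-- **Proposition 5.3, (i) ⇒ (ii): if `J(G)^{(2)} = J(G)^2 + (x_1 ⋯ x_n)`, then every vertex has a
neighbour on every closed walk of odd length.** [cite: HerzogHibiTrung2007, Prop. 5.3] -/
theorem exists_adj_of_odd_closed_walk_of_symbolic_two_eq
    (h : (⨅ p ∈ {p : σ × σ | G.Adj p.1 p.2}, (Ideal.span ({X p.1, X p.2} : Set (MvPolynomial σ k))) ^ 2) =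
      (Ideal.span ((fun W : Finset σ => ∏ i ∈ W, (X i : MvPolynomial σ k)) ''
        {W : Finset σ | ∀ u v, G.Adj u v → u ∈ W ∨ v ∈ W})) ^ 2 ⊔
        Ideal.span {∏ i, (X i : MvPolynomial σ k)})
    {u₀ : σ} (w : G.Walk u₀ u₀) (hodd : Odd w.length) (i₀ : σ) :
    ∃ j ∈ w.support, G.Adj i₀ j := by
  classical
  by_contra hnone
  push Not at hnone
  -- the printed cover: `0` at `i₀`, `1` on the walk, `2` elsewhere
  let a : σ →₀ ℕ := Finsupp.equivFunOnFinite.symm fun i =>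
    if i = i₀ then 0 else if i ∈ w.support then 1 else 2
  have ha : ∀ i, a i = if i = i₀ then 0 else if i ∈ w.support then 1 else 2 := fun i => by
    simp only [a, Finsupp.coe_equivFunOnFinite_symm]
  have hcover : ∀ u v, G.Adj u v → 2 ≤ a u + a v := by
    intro u v huv
    rw [ha, ha]
    by_cases hu : u = i₀
    · subst hu
      have hv : v ∉ w.support := fun hv => hnone v hv huv
      rw [if_pos rfl, if_neg huv.ne.symm, if_neg hv]
    · by_cases hv : v = i₀
      · subst hv
        have hu' : u ∉ w.support := fun hu' => hnone u hu' huv.symm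
        rw [if_neg hu, if_neg hu', if_pos rfl]
      · rw [if_neg hu, if_neg hv]
        split_ifs <;> omega
  have hmem := (monomial_mem_symbolicCoverIdeal_iff G (k := k) 2 a).mpr hcover
  rw [h] at hmem
  rcases monomial_mem_or_of_mem_sup (monomial_mem_coverIdeal_pow_of_mem_support G (k := k) 2)
    (monomial_mem_span_prod_X_of_mem_support (k := k)) hmem with hJ | hX
  · -- two vertex covers below `a` are disjoint along the walk
    obtain ⟨W, hW, hle⟩ := (monomial_mem_coverIdeal_pow_iff G 2 a).mp hJ
    refine (Nat.not_even_iff_odd.mpr hodd) (even_length_of_disjoint_covers G w (hW 0) (hW 1) ?_)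
    intro x y he ⟨hx0, hx1⟩
    have hx : x ∈ w.support := w.fst_mem_support_of_mem_edges he
    have hxi : x ≠ i₀ := by
      rintro rfl
      exact hnone y (w.snd_mem_support_of_mem_edges he) (w.adj_of_mem_edges he)
    have h2 := hle x
    rw [sum_sum_single_apply, ha, if_neg hxi, if_pos hx] at h2
    have hcard : 2 ≤ (univ.filter (fun t : Fin 2 => x ∈ W t)).card := by
      have : univ.filter (fun t : Fin 2 => x ∈ W t) = univ := by
        apply Finset.filter_true_of_mem
        intro t _
        fin_cases t
        · exact hx0
        · exact hx1
      rw [this, Finset.card_univ, Fintype.card_fin]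
    omega
  · have := (monomial_mem_span_prod_X_iff a).mp hX i₀
    rw [ha, if_pos rfl] at this
    omega

/-! ### § 3 (ii) ⇒ (i): splitting a vertex cover of order two -/

/-- **Proposition 5.3, (ii) ⇒ (i), the combinatorial statement**: if every vertex has a neighbour
on every odd closed walk, then every vertex cover `a` of order `2` with a zero is `b + (a − b)`
for a vertex cover `W` (`b = 𝟙_W ≤ a`) with `a − 𝟙_W` again a vertex cover of order `1`.
[cite: HerzogHibiTrung2007, Prop. 5.3 (proof of (ii) ⇒ (i))] -/
theorem exists_vertexCover_le_of_two_cover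
    (hG : ∀ (u₀ : σ) (w : G.Walk u₀ u₀), Odd w.length → ∀ i, ∃ j ∈ w.support, G.Adj i j)
    {a : σ →₀ ℕ} (ha : ∀ u v, G.Adj u v → 2 ≤ a u + a v) {i₀ : σ} (hi₀ : a i₀ = 0) :
    ∃ W : Finset σ, (∀ u v, G.Adj u v → u ∈ W ∨ v ∈ W) ∧
      (∑ i ∈ W, Finsupp.single i 1 : σ →₀ ℕ) ≤ a ∧
      ∀ u v, G.Adj u v → 1 ≤ (a - ∑ i ∈ W, Finsupp.single i 1 : σ →₀ ℕ) u +
        (a - ∑ i ∈ W, Finsupp.single i 1 : σ →₀ ℕ) v := by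
  classical
  -- the induced subgraph on `V = {a = 1}` has no odd closed walk, hence is 2-colourable
  let V : Set σ := {i | a i = 1}
  have hV2 : (G.induce V).Colorable 2 := by
    rw [SimpleGraph.two_colorable_iff_forall_loop_even]
    intro x w'
    by_contra hodd
    rw [Nat.not_even_iff_odd] at hodd
    let w := w'.map (SimpleGraph.Embedding.induce V).toHom
    have hw : Odd w.length := by rwa [SimpleGraph.Walk.length_map]
    obtain ⟨j, hj, hadj⟩ := hG _ w hw i₀
    rw [SimpleGraph.Walk.support_map, List.mem_map] at hj
    obtain ⟨y, -, rfl⟩ := hj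
    have hy : a (y : σ) = 1 := y.2
    have h2 := ha _ _ hadj
    change 2 ≤ a i₀ + a (y : σ) at h2
    omega
  obtain ⟨C⟩ := hV2
  -- `W = {a ≥ 2} ∪ V₁`, `V₁` = the colour-`0` class of `V`
  let W : Finset σ := univ.filter (fun i => 2 ≤ a i ∨ ∃ h : a i = 1, C ⟨i, h⟩ = 0)
  have hmemW : ∀ i, i ∈ W ↔ 2 ≤ a i ∨ ∃ h : a i = 1, C ⟨i, h⟩ = 0 := fun i => by
    simp only [W, Finset.mem_filter, Finset.mem_univ, true_and]
  have hWapp : ∀ j, (∑ i ∈ W, Finsupp.single i 1 : σ →₀ ℕ) j = if j ∈ W then 1 else 0 := by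
    intro j
    rw [Finsupp.finsetSum_apply]
    simp only [Finsupp.single_apply]
    rw [Finset.sum_ite_eq']
  have hWpos : ∀ i ∈ W, 1 ≤ a i := by
    intro i hi
    rcases (hmemW i).mp hi with h | ⟨h, -⟩ <;> omega
  -- an edge with both ends of value `≤ 1` has both ends in `V`, with different colours
  have hedge : ∀ u v, G.Adj u v → a u ≤ 1 → a v ≤ 1 →
      ∃ (hu : a u = 1) (hv : a v = 1), C ⟨u, hu⟩ ≠ C ⟨v, hv⟩ := by
    intro u v huv hu hv
    have h2 := ha u v huv
    have hu1 : a u = 1 := by omega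
    have hv1 : a v = 1 := by omega
    exact ⟨hu1, hv1, C.valid (by exact huv)⟩
  have fin2 : ∀ x y : Fin 2, x ≠ y → x = 0 ∨ y = 0 := by decide
  refine ⟨W, fun u v huv => ?_, fun i => ?_, fun u v huv => ?_⟩
  · by_cases hu : 2 ≤ a u
    · exact Or.inl ((hmemW u).mpr (Or.inl hu))
    by_cases hv : 2 ≤ a v
    · exact Or.inr ((hmemW v).mpr (Or.inl hv))
    obtain ⟨hu1, hv1, hne⟩ := hedge u v huv (by omega) (by omega)
    rcases fin2 _ _ hne with h0 | h0
    · exact Or.inl ((hmemW u).mpr (Or.inr ⟨hu1, h0⟩))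
    · exact Or.inr ((hmemW v).mpr (Or.inr ⟨hv1, h0⟩))
  · rw [hWapp]
    split_ifs with hi
    · exact hWpos i hi
    · exact Nat.zero_le _
  · rw [Finsupp.tsub_apply, Finsupp.tsub_apply, hWapp, hWapp]
    by_cases hu : 2 ≤ a u
    · have : (if u ∈ W then 1 else 0) ≤ 1 := by split_ifs <;> omega
      omega
    by_cases hv : 2 ≤ a v
    · have : (if v ∈ W then 1 else 0) ≤ 1 := by split_ifs <;> omega
      omega
    obtain ⟨hu1, hv1, hne⟩ := hedge u v huv (by omega) (by omega)
    -- the end of colour `≠ 0` is outside `W`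
    rcases fin2 _ _ hne with h0 | h0
    · have hvW : v ∉ W := by
        intro hvW
        rcases (hmemW v).mp hvW with h | ⟨h, h'⟩
        · omega
        · exact hne (h0.trans h'.symm)
      rw [if_neg hvW]
      omega
    · have huW : u ∉ W := by
        intro huW
        rcases (hmemW u).mp huW with h | ⟨h, h'⟩
        · omega
        · exact hne (h'.trans h0.symm)
      rw [if_neg huW]
      omega

omit [Fintype σ] [DecidableEq σ] in
/-- `x^b ∈ J(G)` for every vertex cover `b` of order `1` (its support is a vertex cover).
[cite: HerzogHibiTrung2007, §4 ("`I*(Δ,w)` is generated by the monomials `x^a` such that `a` is a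
vertex cover of order `1`")] -/
theorem monomial_mem_coverIdeal_of_one_cover {b : σ →₀ ℕ} (hb : ∀ u v, G.Adj u v → 1 ≤ b u + b v) :
    (monomial b (1 : k) : MvPolynomial σ k) ∈ Ideal.span ((fun W : Finset σ =>
      ∏ i ∈ W, (X i : MvPolynomial σ k)) '' {W : Finset σ | ∀ u v, G.Adj u v → u ∈ W ∨ v ∈ W}) := by
  classical
  have hle : (∑ i ∈ b.support, Finsupp.single i 1 : σ →₀ ℕ) ≤ b := fun j => by
    rw [Finsupp.finsetSum_apply]
    simp only [Finsupp.single_apply]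
    rw [Finset.sum_ite_eq']
    split_ifs with hj
    · exact Nat.one_le_iff_ne_zero.mpr (Finsupp.mem_support_iff.mp hj)
    · exact Nat.zero_le _
  have hsplit : (monomial b (1 : k) : MvPolynomial σ k) =
      monomial (b - ∑ i ∈ b.support, Finsupp.single i 1) (1 : k) * ∏ i ∈ b.support, (X i : MvPolynomial σ k) := by
    rw [prod_X_eq_monomial_sum_single, monomial_mul, mul_one, tsub_add_cancel_of_le hle]
  rw [hsplit]
  refine Ideal.mul_mem_left _ _ (Ideal.subset_span ⟨b.support, fun u v huv => ?_, rfl⟩)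
  have h := hb u v huv
  by_contra hnot
  push Not at hnot
  rw [Finsupp.notMem_support_iff.mp hnot.1, Finsupp.notMem_support_iff.mp hnot.2] at h
  omega

/-- **Proposition 5.3, (ii) ⇒ (i): if every vertex has a neighbour on every closed walk of odd
length, then `J(G)^{(2)} = J(G)^2 + (x_1 ⋯ x_n)`.** [cite: HerzogHibiTrung2007, Prop. 5.3] -/
theorem symbolic_two_eq_of_forall_odd_closed_walk
    (hG : ∀ (u₀ : σ) (w : G.Walk u₀ u₀), Odd w.length → ∀ i, ∃ j ∈ w.support, G.Adj i j) :
    (⨅ p ∈ {p : σ × σ | G.Adj p.1 p.2}, (Ideal.span ({X p.1, X p.2} : Set (MvPolynomial σ k))) ^ 2) =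
      (Ideal.span ((fun W : Finset σ => ∏ i ∈ W, (X i : MvPolynomial σ k)) ''
        {W : Finset σ | ∀ u v, G.Adj u v → u ∈ W ∨ v ∈ W})) ^ 2 ⊔
        Ideal.span {∏ i, (X i : MvPolynomial σ k)} := by
  classical
  refine le_antisymm ?_ (sq_sup_span_prod_X_le_symbolic_two G)
  intro f hf
  rw [f.as_sum]
  refine Ideal.sum_mem _ fun a haf => ?_
  have hcov := (monomial_mem_symbolicCoverIdeal_iff G 2 a).mp
    (monomial_mem_symbolicCoverIdeal_of_mem_support G 2 f hf a haf)
  have hCmul : monomial a (f.coeff a) = C (f.coeff a) * monomial a (1 : k) := by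
    rw [C_mul_monomial, mul_one]
  rw [hCmul]
  refine Ideal.mul_mem_left _ _ ?_
  by_cases hzero : ∃ i₀, a i₀ = 0
  · obtain ⟨i₀, hi₀⟩ := hzero
    obtain ⟨W, hW, hle, hrest⟩ := exists_vertexCover_le_of_two_cover G hG hcov hi₀
    refine Ideal.mem_sup_left ?_
    have hsplit : (monomial a (1 : k) : MvPolynomial σ k) =
        monomial (a - ∑ i ∈ W, Finsupp.single i 1) (1 : k) * ∏ i ∈ W, (X i : MvPolynomial σ k) := by
      rw [prod_X_eq_monomial_sum_single, monomial_mul, mul_one, tsub_add_cancel_of_le hle]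
    rw [hsplit, pow_two]
    exact Ideal.mul_mem_mul (monomial_mem_coverIdeal_of_one_cover G hrest)
      (Ideal.subset_span ⟨W, hW, rfl⟩)
  · push Not at hzero
    exact Ideal.mem_sup_right ((monomial_mem_span_prod_X_iff a).mpr
      fun i => Nat.one_le_iff_ne_zero.mpr (hzero i))

/-! ### § 4 Proposition 5.3 -/

/-- **Proposition 5.3 (Herzog–Hibi–Trung): `J(G)^{(2)} = J(G)^2 + (x_1 ⋯ x_n)` — the vertex cover
algebra is generated by `x_1 ⋯ x_n t^2` and the (minimal) vertex covers — iff every vertex of `G`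
has a neighbour on every closed walk of odd length.** [cite: HerzogHibiTrung2007, Prop. 5.3] -/
theorem symbolic_two_eq_sq_sup_span_prod_X_iff :
    (⨅ p ∈ {p : σ × σ | G.Adj p.1 p.2}, (Ideal.span ({X p.1, X p.2} : Set (MvPolynomial σ k))) ^ 2) =
      (Ideal.span ((fun W : Finset σ => ∏ i ∈ W, (X i : MvPolynomial σ k)) ''
        {W : Finset σ | ∀ u v, G.Adj u v → u ∈ W ∨ v ∈ W})) ^ 2 ⊔
        Ideal.span {∏ i, (X i : MvPolynomial σ k)} ↔
      ∀ (u₀ : σ) (w : G.Walk u₀ u₀), Odd w.length → ∀ i, ∃ j ∈ w.support, G.Adj i j :=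
  ⟨fun h _ w hw i => exists_adj_of_odd_closed_walk_of_symbolic_two_eq G h w hw i,
    symbolic_two_eq_of_forall_odd_closed_walk G⟩

/-- Bipartite graphs have no closed walks of odd length, so `J(G)^{(2)} = J(G)^2 + (x_1 ⋯ x_n)` (indeed
`= J(G)^2`, Theorem 5.1 (b)). [cite: HerzogHibiTrung2007, Prop. 5.3 and Thm. 5.1 (b)] -/
theorem symbolic_two_eq_sq_sup_span_prod_X_of_colorable_two (hc : G.Colorable 2) :
    (⨅ p ∈ {p : σ × σ | G.Adj p.1 p.2}, (Ideal.span ({X p.1, X p.2} : Set (MvPolynomial σ k))) ^ 2) =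
      (Ideal.span ((fun W : Finset σ => ∏ i ∈ W, (X i : MvPolynomial σ k)) ''
        {W : Finset σ | ∀ u v, G.Adj u v → u ∈ W ∨ v ∈ W})) ^ 2 ⊔
        Ideal.span {∏ i, (X i : MvPolynomial σ k)} := by
  refine symbolic_two_eq_of_forall_odd_closed_walk G fun u₀ w hw _ => ?_
  exact absurd (SimpleGraph.two_colorable_iff_forall_loop_even.mp hc u₀ w) (Nat.not_even_iff_odd.mpr hw)

end Literature.AlgebraicGeometry.ProjectiveSpace
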